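import Mathlib.RingTheory.UniqueFactorizationDomain.Moebius
import Mathlib.RingTheory.UniqueFactorizationDomain.Multiplicative
import Literature.NumberTheory.LFunctions.GaussianHeckeVonMangoldt
import HarnessLib

/-!
# Möbius inversion over `ℤ[i]*`: `∑_{d ∈ ℤ[i]*, d ∣ z} μ(d) = [z = 1]`

Topic `Literature/NumberTheory/LFunctions`, arithmetic brick for the mollifier
`M_X(s) = ∑_{d ∈ ℤ[i]*, N(d) ≤ X} μ(d) λ^m(d) N(d)^{-s}` of the zero-detection method for the Hecke
`L`-functions `D_m = 4 L(·, λ^m)` of `ℚ(i)` (the proof of Ricci's zero-density estimate,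
`Literature.NumberTheory.LFunctions.GaussianHecke.ricci_zeroDensity`).  The Möbius function itself is
Mathlib's `UniqueFactorizationMonoid.moebius` on the unique factorisation monoid `ℤ[i]`
(`μ(z) = (-1)^{#factors}` for squarefree `z`, `0` otherwise; association-invariant, multiplicative on
relatively prime elements).  This file introduces ONE definition — the finite set `divisorsStar z` of the
divisors of `z` lying in Harman's first quadrant `ℤ[i]*` (one per divisor CLASS, `GaussianHecke.q1`) —
and PROVES

* `mem_divisorsStar`, `divisorsStar_eq_of_associated`, `divisorsStar_of_isUnit`;
* `divisorsStar_prime_pow` — the divisor classes of `p^i` are `q1(p^j)`, `j ≤ i`;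
* `divisorsStar_mul`, `injOn_q1_mul_of_isRelPrime` — for relatively prime `x, y`,
  `(d₁, d₂) ↦ q1(d₁ d₂)` is a bijection `divisorsStar x × divisorsStar y ≃ divisorsStar (xy)`
  (decomposition monoid: `d ∣ xy ⇒ d = a₁ a₂`, `a₁ ∣ x`, `a₂ ∣ y`);
* `sum_divisorsStar_moebius` — **Möbius inversion**: for `z ≠ 0`,
  `∑_{d ∈ divisorsStar z} μ(d) = 1` if `z` is a unit and `= 0` otherwise
  (Mathlib's `UniqueFactorizationMonoid.induction_on_coprime`: units, prime powers `1 − 1 + 0 + ⋯`,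
  and multiplicativity over relatively prime factors).

## References

* G. H. Hardy, E. M. Wright, *An Introduction to the Theory of Numbers*, Thm. 263 (the model over `ℤ`);
  the statement over the Gaussian integers is [folklore].
-/

noncomputable section

open Finset UniqueFactorizationMonoid

namespace Literature.NumberTheory.LFunctions

namespace GaussianHecke

open GaussianInt
open Literature.NumberTheory.QuadraticFields.GaussianPrimary (norm_dvd_norm)

open scoped Classical

/-! ### Divisors in the first quadrant -/

/-- The divisors of `z` lying in `ℤ[i]*` (first quadrant: `re > 0`, `im ≥ 0`) — one representative of
every class of associated divisors of `z ≠ 0`; realised inside `{d : N(d) ≤ N(z)}`. [folklore] -/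
def divisorsStar (z : _root_.GaussianInt) : Finset _root_.GaussianInt :=
  (normLE (z.norm : ℝ)).filter fun d ↦ d ∈ firstQuadrant ∧ d ∣ z

/-- A divisor of `z ≠ 0` has norm at most `N(z)`. [folklore] -/
theorem norm_le_norm_of_dvd {d z : _root_.GaussianInt} (h : d ∣ z) (hz : z ≠ 0) : d.norm ≤ z.norm := by
  obtain ⟨e, rfl⟩ := h
  have he : e ≠ 0 := right_ne_zero_of_mul hz
  have h1 : 1 ≤ e.norm := by
    have := GaussianInt.norm_pos.2 he
    omega
  have hd : 0 ≤ d.norm := GaussianInt.norm_nonneg d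
  rw [Zsqrtd.norm_mul]
  nlinarith

/-- Membership in `divisorsStar z` (`z ≠ 0`): `d ∈ ℤ[i]*` and `d ∣ z`. [folklore] -/
theorem mem_divisorsStar {z d : _root_.GaussianInt} (hz : z ≠ 0) : d ∈ divisorsStar z ↔ d ∈ firstQuadrant ∧ d ∣ z := by
  unfold divisorsStar
  rw [mem_filter, mem_normLE]
  constructor
  · exact fun h ↦ h.2
  · intro h
    exact ⟨by exact_mod_cast norm_le_norm_of_dvd h.2 hz, h⟩

/-- Associated elements have the same first-quadrant divisors. [folklore] -/
theorem divisorsStar_eq_of_associated {z w : _root_.GaussianInt} (h : Associated z w) (hz : z ≠ 0) :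
    divisorsStar z = divisorsStar w := by
  have hw : w ≠ 0 := h.ne_zero_iff.1 hz
  ext d
  rw [mem_divisorsStar hz, mem_divisorsStar hw, h.dvd_iff_dvd_right]

/-- An element of `ℤ[i]*` which is a unit is `1`. [folklore] -/
theorem eq_one_of_isUnit_of_mem {u : _root_.GaussianInt} (hu : IsUnit u) (h : u ∈ firstQuadrant) : u = 1 :=
  eq_of_associated (associated_one_iff_isUnit.2 hu) h (by simp [mem_firstQuadrant])

/-- `1 ∈ divisorsStar z` for `z ≠ 0`. [folklore] -/
theorem one_mem_divisorsStar {z : _root_.GaussianInt} (hz : z ≠ 0) : 1 ∈ divisorsStar z :=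
  (mem_divisorsStar hz).2 ⟨by simp [mem_firstQuadrant], one_dvd z⟩

/-- The first-quadrant divisors of a unit: just `1`. [folklore] -/
theorem divisorsStar_of_isUnit {u : _root_.GaussianInt} (hu : IsUnit u) : divisorsStar u = {1} := by
  ext d
  rw [mem_divisorsStar hu.ne_zero, mem_singleton]
  constructor
  · rintro ⟨hd, hdu⟩
    exact eq_one_of_isUnit_of_mem (isUnit_of_dvd_unit hdu hu) hd
  · rintro rfl
    exact ⟨by simp [mem_firstQuadrant], one_dvd u⟩

/-! ### Prime powers -/

/-- The first-quadrant divisors of `p^i` (`p` prime) are the `q1(p^j)`, `j ≤ i`. [folklore] -/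
theorem divisorsStar_prime_pow {p : _root_.GaussianInt} (hp : Prime p) (i : ℕ) :
    divisorsStar (p ^ i) = (range (i + 1)).image fun j ↦ q1 (p ^ j) := by
  have hpi : p ^ i ≠ 0 := pow_ne_zero i hp.ne_zero
  ext d
  rw [mem_divisorsStar hpi, mem_image]
  constructor
  · rintro ⟨hd, hdvd⟩
    obtain ⟨j, hj, hassoc⟩ := (dvd_prime_pow hp i).1 hdvd
    refine ⟨j, mem_range.2 (by omega), ?_⟩
    rw [← q1_of_mem hd]
    exact (q1_eq_q1 hassoc (ne_zero_of_mem_firstQuadrant' hd)).symm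
  · rintro ⟨j, hj, rfl⟩
    have hpj : p ^ j ≠ 0 := pow_ne_zero j hp.ne_zero
    refine ⟨q1_mem hpj, (associated_q1 _).dvd.trans ?_⟩
    exact pow_dvd_pow p (by rw [mem_range] at hj; omega)
where
  /-- Elements of `ℤ[i]*` are nonzero (local copy for this namespace). [folklore] -/
  ne_zero_of_mem_firstQuadrant' {n : _root_.GaussianInt} (h : n ∈ firstQuadrant) : n ≠ 0 := by
    rintro rfl
    exact (lt_irrefl (0 : ℤ)) (by simpa using h.1)

/-- Elements of `ℤ[i]*` are nonzero. [folklore] -/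
theorem ne_zero_of_mem_fq {n : _root_.GaussianInt} (h : n ∈ firstQuadrant) : n ≠ 0 := by
  rintro rfl
  exact (lt_irrefl (0 : ℤ)) (by simpa using h.1)

/-- Distinct exponents give non-associated prime powers. [folklore] -/
theorem eq_of_associated_prime_pow {p : _root_.GaussianInt} (hp : Prime p) {j k : ℕ}
    (h : Associated (p ^ j) (p ^ k)) : j = k := by
  have h1 : p ^ j ∣ p ^ k := h.dvd
  have h2 : p ^ k ∣ p ^ j := h.symm.dvd
  have hj : j ≤ k := (pow_dvd_pow_iff hp.ne_zero hp.not_unit).1 h1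
  have hk : k ≤ j := (pow_dvd_pow_iff hp.ne_zero hp.not_unit).1 h2
  omega

/-- `μ(p^j)`: `1, -1, 0, 0, …`. [folklore] -/
theorem moebius_prime_pow {p : _root_.GaussianInt} (hp : Prime p) (j : ℕ) :
    moebius (p ^ j) = if j = 0 then 1 else if j = 1 then -1 else 0 := by
  rcases j with _ | _ | j
  · simp
  · simp [hp.irreducible.moebius_eq]
  · have hns : ¬ Squarefree (p ^ (j + 2)) := by
      intro hsq
      have h := hsq p ⟨p ^ j, by ring⟩
      exact hp.not_unit h
    rw [moebius_of_not_squarefree hns]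
    simp

/-- The Möbius sum over the divisor classes of a prime power vanishes:
`∑_{j ≤ i} μ(p^j) = 1 − 1 = 0` for `i ≥ 1`. [folklore] -/
theorem sum_divisorsStar_moebius_prime_pow {p : _root_.GaussianInt} (hp : Prime p) {i : ℕ} (hi : 1 ≤ i) :
    ∑ d ∈ divisorsStar (p ^ i), moebius d = 0 := by
  rw [divisorsStar_prime_pow hp i, sum_image]
  · have hμ : ∀ j ∈ range (i + 1), moebius (q1 (p ^ j)) = if j = 0 then 1 else if j = 1 then -1 else 0 := by
      intro j _
      rw [(associated_q1 (p ^ j)).moebius_eq, moebius_prime_pow hp j]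
    rw [sum_congr rfl hμ]
    have h01 : ({0, 1} : Finset ℕ) ⊆ range (i + 1) := by
      intro j hj
      simp only [mem_insert, mem_singleton] at hj
      rw [mem_range]; omega
    rw [← sum_subset h01]
    · simp
    · intro j _ hj
      simp only [mem_insert, mem_singleton, not_or] at hj
      simp [hj.1, hj.2]
  · intro j _ k _ hjk
    have hjk' : q1 (p ^ j) = q1 (p ^ k) := hjk
    have h : Associated (p ^ j) (p ^ k) :=
      ((associated_q1 (p ^ j)).symm.trans (by rw [hjk'])).trans (associated_q1 (p ^ k))
    exact eq_of_associated_prime_pow hp h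

/-! ### Relatively prime factors -/

/-- Divisors of relatively prime elements are relatively prime. [folklore] -/
theorem isRelPrime_of_dvd_of_dvd {x y d₁ d₂ : _root_.GaussianInt} (h : IsRelPrime x y) (h₁ : d₁ ∣ x) (h₂ : d₂ ∣ y) :
    IsRelPrime d₁ d₂ :=
  fun _ he₁ he₂ ↦ h (he₁.trans h₁) (he₂.trans h₂)

/-- For `x, y ≠ 0`, the first-quadrant divisors of `xy` are exactly the `q1(d₁ d₂)`,
`d₁ ∈ divisorsStar x`, `d₂ ∈ divisorsStar y` (decomposition monoid). [folklore] -/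
theorem divisorsStar_mul {x y : _root_.GaussianInt} (hx : x ≠ 0) (hy : y ≠ 0) :
    divisorsStar (x * y) = (divisorsStar x ×ˢ divisorsStar y).image fun p ↦ q1 (p.1 * p.2) := by
  have hxy : x * y ≠ 0 := mul_ne_zero hx hy
  ext d
  rw [mem_divisorsStar hxy, mem_image]
  constructor
  · rintro ⟨hd, hdvd⟩
    obtain ⟨a₁, a₂, ha₁, ha₂, rfl⟩ := exists_dvd_and_dvd_of_dvd_mul hdvd
    have h₁ : a₁ ≠ 0 := left_ne_zero_of_mul (ne_zero_of_mem_fq hd)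
    have h₂ : a₂ ≠ 0 := right_ne_zero_of_mul (ne_zero_of_mem_fq hd)
    refine ⟨(q1 a₁, q1 a₂), mem_product.2 ⟨(mem_divisorsStar hx).2 ⟨q1_mem h₁, (associated_q1 _).dvd.trans ha₁⟩,
      (mem_divisorsStar hy).2 ⟨q1_mem h₂, (associated_q1 _).dvd.trans ha₂⟩⟩, ?_⟩
    dsimp only
    rw [← q1_of_mem hd]
    exact q1_eq_q1 ((associated_q1 a₁).mul_mul (associated_q1 a₂)) (mul_ne_zero (q1_mem h₁ |>
      ne_zero_of_mem_fq) (q1_mem h₂ |> ne_zero_of_mem_fq))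
  · rintro ⟨⟨d₁, d₂⟩, hmem, rfl⟩
    rw [mem_product] at hmem
    obtain ⟨hd₁, hd₁x⟩ := (mem_divisorsStar hx).1 hmem.1
    obtain ⟨hd₂, hd₂y⟩ := (mem_divisorsStar hy).1 hmem.2
    have h0 : d₁ * d₂ ≠ 0 := mul_ne_zero (ne_zero_of_mem_fq hd₁) (ne_zero_of_mem_fq hd₂)
    exact ⟨q1_mem h0, (associated_q1 _).dvd.trans (mul_dvd_mul hd₁x hd₂y)⟩

/-- Injectivity of `(d₁, d₂) ↦ q1(d₁ d₂)` on `divisorsStar x × divisorsStar y` for relatively prime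
`x, y`. [folklore] -/
theorem injOn_q1_mul_of_isRelPrime {x y : _root_.GaussianInt} (h : IsRelPrime x y) (hx : x ≠ 0) (hy : y ≠ 0) :
    Set.InjOn (fun p : _root_.GaussianInt × _root_.GaussianInt ↦ q1 (p.1 * p.2)) ↑(divisorsStar x ×ˢ divisorsStar y) := by
  rintro ⟨d₁, d₂⟩ hd ⟨e₁, e₂⟩ he heq
  simp only [coe_product, Set.mem_prod, mem_coe] at hd he
  obtain ⟨hd₁, hd₁x⟩ := (mem_divisorsStar hx).1 hd.1
  obtain ⟨hd₂, hd₂y⟩ := (mem_divisorsStar hy).1 hd.2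
  obtain ⟨he₁, he₁x⟩ := (mem_divisorsStar hx).1 he.1
  obtain ⟨he₂, he₂y⟩ := (mem_divisorsStar hy).1 he.2
  dsimp only at heq
  -- `d₁ d₂ ~ e₁ e₂`
  have hassoc : Associated (d₁ * d₂) (e₁ * e₂) :=
    ((associated_q1 _).symm.trans (by rw [heq])).trans (associated_q1 _)
  -- `d₁ ∣ e₁ e₂` with `d₁` relatively prime to `e₂`, hence `d₁ ∣ e₁`; symmetrically
  have h1 : d₁ ∣ e₁ :=
    (isRelPrime_of_dvd_of_dvd h hd₁x he₂y).dvd_of_dvd_mul_right (dvd_trans (dvd_mul_right d₁ d₂) hassoc.dvd)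
  have h1' : e₁ ∣ d₁ :=
    (isRelPrime_of_dvd_of_dvd h he₁x hd₂y).dvd_of_dvd_mul_right
      (dvd_trans (dvd_mul_right e₁ e₂) hassoc.symm.dvd)
  have h2 : d₂ ∣ e₂ :=
    (isRelPrime_of_dvd_of_dvd h.symm hd₂y he₁x).dvd_of_dvd_mul_left
      (dvd_trans (dvd_mul_left d₂ d₁) hassoc.dvd)
  have h2' : e₂ ∣ d₂ :=
    (isRelPrime_of_dvd_of_dvd h.symm he₂y hd₁x).dvd_of_dvd_mul_left
      (dvd_trans (dvd_mul_left e₂ e₁) hassoc.symm.dvd)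
  have heq1 : d₁ = e₁ := eq_of_associated (associated_of_dvd_dvd h1 h1') hd₁ he₁
  have heq2 : d₂ = e₂ := eq_of_associated (associated_of_dvd_dvd h2 h2') hd₂ he₂
  rw [heq1, heq2]

/-- Multiplicativity of the Möbius sum over relatively prime factors. [folklore] -/
theorem sum_divisorsStar_moebius_mul {x y : _root_.GaussianInt} (h : IsRelPrime x y) (hx : x ≠ 0) (hy : y ≠ 0) :
    ∑ d ∈ divisorsStar (x * y), moebius d =
      (∑ d ∈ divisorsStar x, moebius d) * ∑ d ∈ divisorsStar y, moebius d := by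
  rw [divisorsStar_mul hx hy, sum_image (injOn_q1_mul_of_isRelPrime h hx hy),
    sum_product, sum_mul_sum]
  refine sum_congr rfl fun d₁ hd₁ ↦ sum_congr rfl fun d₂ hd₂ ↦ ?_
  obtain ⟨-, hd₁x⟩ := (mem_divisorsStar hx).1 hd₁
  obtain ⟨-, hd₂y⟩ := (mem_divisorsStar hy).1 hd₂
  rw [(associated_q1 _).moebius_eq, (isRelPrime_of_dvd_of_dvd h hd₁x hd₂y).moebius_mul]

/-! ### Möbius inversion -/

/-- **Möbius inversion over `ℤ[i]*`:** for `z ≠ 0`, `∑_{d ∈ ℤ[i]*, d ∣ z} μ(d)` is `1` if `z` is a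
unit and `0` otherwise. [folklore] -/
theorem sum_divisorsStar_moebius {z : _root_.GaussianInt} (hz : z ≠ 0) :
    ∑ d ∈ divisorsStar z, moebius d = if IsUnit z then 1 else 0 := by
  revert hz
  refine induction_on_coprime z (fun h ↦ (h rfl).elim) (fun hu _ ↦ ?_) (fun {p} i hp _ ↦ ?_)
    (fun {x y} hxy ihx ihy hxy0 ↦ ?_)
  · rw [if_pos hu, divisorsStar_of_isUnit hu, sum_singleton, moebius_one]
  · rcases Nat.eq_zero_or_pos i with rfl | hi
    · rw [pow_zero, if_pos isUnit_one, divisorsStar_of_isUnit isUnit_one, sum_singleton, moebius_one]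
    · rw [sum_divisorsStar_moebius_prime_pow hp hi, if_neg]
      exact fun hu ↦ hp.not_unit (isUnit_of_dvd_unit (dvd_pow_self p (by omega)) hu)
  · have hx : x ≠ 0 := left_ne_zero_of_mul hxy0
    have hy : y ≠ 0 := right_ne_zero_of_mul hxy0
    rw [sum_divisorsStar_moebius_mul hxy hx hy, ihx hx, ihy hy]
    simp only [IsUnit.mul_iff]
    by_cases h1 : IsUnit x <;> by_cases h2 : IsUnit y <;> simp [h1, h2]

/-- **Möbius inversion on `ℤ[i]*`** in the form used by mollifiers: for `z ∈ ℤ[i]*`,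
`∑_{d ∈ ℤ[i]*, d ∣ z} μ(d) = [z = 1]`. [folklore] -/
theorem sum_divisorsStar_moebius_of_mem {z : _root_.GaussianInt} (hz : z ∈ firstQuadrant) :
    ∑ d ∈ divisorsStar z, moebius d = if z = 1 then 1 else 0 := by
  rw [sum_divisorsStar_moebius (ne_zero_of_mem_fq hz)]
  by_cases h : z = 1
  · rw [if_pos h, if_pos (h ▸ isUnit_one)]
  · rw [if_neg h, if_neg (fun hu ↦ h (eq_one_of_isUnit_of_mem hu hz))]

/-- `|μ(z)| ≤ 1`. [folklore] -/
theorem abs_moebius_le_one (z : _root_.GaussianInt) : |moebius z| ≤ 1 := by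
  unfold moebius
  split_ifs
  · rw [abs_pow, abs_neg, abs_one, one_pow]
  · simp

end GaussianHecke

end Literature.NumberTheory.LFunctions
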